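import Literature.NumberTheory.EllipticCurves.Kobayashi2003.SignedKatoDivisibility
import Mathlib.RingTheory.Polynomial.Cyclotomic.Roots
import Mathlib.FieldTheory.IsAlgClosed.Basic
import HarnessLib

/-!
# Pollack's `L_p^±` are DETERMINED by the Mazur–Tate congruences (proofs; no named fact)

Topic `Literature/NumberTheory/EllipticCurves`, cluster `Kobayashi2003`; sibling PROOF file of
`SignedKatoDivisibility.lean` (p209183), whose predicate `IsSignedPAdicLFunction f p ε L` says "`L ∈ Λ`
satisfies Pollack's congruences `θ_n ≡ (-1)^{⌊n/2⌋+1} ω_n^∓ L (mod ω_n)` at every level `n` with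
`(-1)^n = ε`" (Kobayashi's labelling of Pollack's `L_p^±`, Invent. Math. 152 (2003) Thm. 3.2 and
(3.4)–(3.5); Pollack, Duke Math. J. 118 (2003) Prop. 6.18), and whose named fact
`thm41_signedCharIdeal_divisibility` (Kobayashi Thm. 1.3 / 4.1) quantifies over EVERY such `L`.
This file PROVES that such an `L` is unique (`IsSignedPAdicLFunction.unique`), so that "for every
`L` with `IsSignedPAdicLFunction f p ε L`" says exactly "for Pollack's `L_p^ε(E, X)`" — the typed fact
is thereby not stronger than the printed theorem on this count. Everything is proved (net debt 0);
HONEST FRAMING (cell `b2b-bsdres`, harvest seat 2, gen 12): nothing about any curve is asserted.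

Argument (Pollack 2003, §6.3 / proof of Prop. 6.9: the congruences are the interpolation property,
and an Iwasawa function is determined by its values at the `ζ - 1`): if `L₁, L₂` both satisfy the
parity-`ε` congruences then at every primitive `p^n`-th root of unity `ζ ∈ ℂ_p` with `(-1)^n = ε`
both `∑_k l^{(i)}_k (ζ - 1)^k` equal `θ_n(ζ - 1) / ((-1)^{⌊n/2⌋+1} ω_n^∓(ζ - 1))`
(`IsCongrModOmega.eval₂_eq`; the denominator is non-zero by `eval₂_cyclotomicOmegaPlus/Minus_ne_zero`,
Pollack Lemma 4.7), so `L₁ - L₂ ∈ Λ` vanishes at the infinitely many points `ζ_n - 1` (`n` of parity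
`ε`; primitive roots exist in the algebraically closed field `ℂ_p`) of the open unit disc; a non-zero
element of `Λ ⊗ ℚ_p` has only finitely many zeros there (`MemIwasawaRat.finite_setOf_hasSum_zero`,
Weierstrass preparation), hence `L₁ = L₂`.

## Contents

* `IsSignedPAdicLFunction.tsum_eq` — two solutions have the same value at every `ζ - 1`, `ζ` a
  primitive `p^n`-th root of unity with `(-1)^n = ε`;
* `IsSignedPAdicLFunction.unique` — **two solutions are equal**;
* `existsUnique_isSignedPAdicLFunction` — granted the tree's Pollack fact: for each sign there is
  EXACTLY ONE `L ∈ Λ` with `IsSignedPAdicLFunction f p ε L` (and it is non-zero).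

References: [Pollack2003] Prop. 6.18, Prop. 6.9 (proof), Lemma 4.7, §3; [Kobayashi2003] Thm. 3.2,
(3.4)–(3.5) (p. 7); L. Washington, GTM 83, Thm. 7.3 (zeros of Iwasawa functions).
-/

noncomputable section

open scoped MatrixGroups ModularForm

open CongruenceSubgroup Polynomial Literature.NumberTheory.EllipticCurves
  Literature.NumberTheory.EllipticCurves.ModularForms

namespace Literature.NumberTheory.EllipticCurves.Kobayashi2003

variable {N : ℕ} {f : CuspForm (Gamma0 N) 2} {p : ℕ} [Fact p.Prime]

/-- Primitive `p^n`-th roots of unity exist in `ℂ_p` (algebraically closed of characteristic `0`).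
[folklore] -/
private theorem exists_isPrimitiveRoot_padicComplex (n : ℕ) :
    ∃ ζ : ℂ_[p], IsPrimitiveRoot ζ (p ^ n) := by
  have hpos : 0 < p ^ n := pow_pos (Fact.out : p.Prime).pos n
  obtain ⟨ζ, hζ⟩ := IsAlgClosed.exists_root (cyclotomic (p ^ n) ℂ_[p])
    (degree_cyclotomic_pos (p ^ n) ℂ_[p] hpos).ne'
  exact ⟨ζ, (isRoot_cyclotomic_iff_charZero hpos).mp hζ⟩

/-- **Two solutions of the parity-`ε` congruences agree at every `ζ - 1`**, `ζ ∈ ℂ_p` a primitive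
`p^n`-th root of unity with `(-1)^n = ε`: both values `∑_k l_k (ζ - 1)^k` equal
`θ_n(ζ - 1) / ((-1)^{⌊n/2⌋+1} ω_n^∓(ζ - 1))` (`IsCongrModOmega.eval₂_eq`, and `ω_n^∓(ζ - 1) ≠ 0` by
Pollack's Lemma 4.7). [cite: Pollack2003, Prop. 6.18 (proof) and Lemma 4.7] -/
theorem IsSignedPAdicLFunction.tsum_eq {ε : ℤˣ} {L₁ L₂ : IwasawaAlgebra p}
    (h₁ : IsSignedPAdicLFunction f p ε L₁) (h₂ : IsSignedPAdicLFunction f p ε L₂)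
    {n : ℕ} (hn : (n : ℤ).negOnePow = ε) {ζ : ℂ_[p]} (hζ : IsPrimitiveRoot ζ (p ^ n)) :
    ∑' k, ((algebraMap ℚ_[p] ℂ_[p]).comp (algebraMap ℤ_[p] ℚ_[p])) (PowerSeries.coeff k L₁) *
        (ζ - 1) ^ k =
      ∑' k, ((algebraMap ℚ_[p] ℂ_[p]).comp (algebraMap ℤ_[p] ℚ_[p])) (PowerSeries.coeff k L₂) *
        (ζ - 1) ^ k := by
  have hpow : ζ ^ p ^ n = 1 := hζ.pow_eq_one
  have hz : ‖ζ - 1‖ < 1 := norm_sub_one_lt_one_of_pow_prime_pow_eq_one hpow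
  have hzn : (1 + (ζ - 1)) ^ p ^ n = 1 := by rwa [add_sub_cancel]
  have hsign : ((-1 : ℂ_[p]) ^ (n / 2 + 1)) ≠ 0 := pow_ne_zero _ (neg_ne_zero.mpr one_ne_zero)
  rcases Int.units_eq_one_or ε with rfl | rfl
  · have he : Even n := by rwa [Int.negOnePow_eq_one_iff, Int.even_coe_nat] at hn
    have e₁ := ((isSignedPAdicLFunction_one_iff f p L₁).mp h₁ n he).eval₂_eq hz hzn
    have e₂ := ((isSignedPAdicLFunction_one_iff f p L₂).mp h₂ n he).eval₂_eq hz hzn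
    rw [eval₂_mul, eval₂_pow, eval₂_neg, eval₂_one] at e₁ e₂
    have hω := eval₂_cyclotomicOmegaMinus_ne_zero (p := p) he hζ
    exact mul_left_cancel₀ (mul_ne_zero hsign hω) (e₁.symm.trans e₂)
  · have ho : Odd n := by rwa [Int.negOnePow_eq_neg_one_iff, Int.odd_coe_nat] at hn
    have e₁ := ((isSignedPAdicLFunction_neg_one_iff f p L₁).mp h₁ n ho).eval₂_eq hz hzn
    have e₂ := ((isSignedPAdicLFunction_neg_one_iff f p L₂).mp h₂ n ho).eval₂_eq hz hzn
    rw [eval₂_mul, eval₂_pow, eval₂_neg, eval₂_one] at e₁ e₂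
    have hω := eval₂_cyclotomicOmegaPlus_ne_zero (p := p) ho hζ
    exact mul_left_cancel₀ (mul_ne_zero hsign hω) (e₁.symm.trans e₂)

/-- The uniqueness argument along an injective family of levels of parity `ε`. [folklore] -/
private theorem IsSignedPAdicLFunction.eq_of_levels {ε : ℤˣ} {L₁ L₂ : IwasawaAlgebra p}
    (h₁ : IsSignedPAdicLFunction f p ε L₁) (h₂ : IsSignedPAdicLFunction f p ε L₂)
    (lev : ℕ → ℕ) (hinj : Function.Injective lev) (hlev : ∀ k, ((lev k : ℕ) : ℤ).negOnePow = ε) :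
    L₁ = L₂ := by
  have hp : p.Prime := Fact.out
  by_contra hne
  set D : IwasawaAlgebra p := L₁ - L₂ with hDdef
  have hD : D ≠ 0 := sub_ne_zero.mpr hne
  have hD' : iwasawaToPowerSeries p D ≠ 0 := fun h0 ↦
    hD (iwasawaToPowerSeries_injective p (by rw [h0, map_zero]))
  have hfin := MemIwasawaRat.finite_setOf_hasSum_zero (memIwasawaRat_iwasawaToPowerSeries p D) hD'
  choose ζ hζ using fun k ↦ exists_isPrimitiveRoot_padicComplex (p := p) (lev k)
  have hcoe : ∀ (L : IwasawaAlgebra p) (k : ℕ),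
      algebraMap ℚ_[p] ℂ_[p] (PowerSeries.coeff k (iwasawaToPowerSeries p L)) =
        ((algebraMap ℚ_[p] ℂ_[p]).comp (algebraMap ℤ_[p] ℚ_[p])) (PowerSeries.coeff k L) := by
    intro L k
    simp only [RingHom.comp_apply, iwasawaToPowerSeries, PowerSeries.coeff_map]
  -- every `ζ_k - 1` is a zero of `D` in the open unit disc
  have hmem : ∀ k, ζ k - 1 ∈ {z : ℂ_[p] | ‖z‖ < 1 ∧
      HasSum (fun j ↦ algebraMap ℚ_[p] ℂ_[p] (PowerSeries.coeff j (iwasawaToPowerSeries p D)) *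
        z ^ j) 0} := by
    intro k
    have hz : ‖ζ k - 1‖ < 1 := norm_sub_one_lt_one_of_pow_prime_pow_eq_one (hζ k).pow_eq_one
    refine ⟨hz, ?_⟩
    have hs₁ := (summable_map_coeff_mul_pow _ (norm_algebraMap_coeff_le_one L₁) hz).hasSum
    have hs₂ := (summable_map_coeff_mul_pow _ (norm_algebraMap_coeff_le_one L₂) hz).hasSum
    have heq := h₁.tsum_eq h₂ (hlev k) (hζ k)
    have hsub := hs₁.sub hs₂
    rw [heq, sub_self] at hsub
    have hfun : (fun j ↦ algebraMap ℚ_[p] ℂ_[p] (PowerSeries.coeff j (iwasawaToPowerSeries p D)) *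
        (ζ k - 1) ^ j) = fun j ↦
        ((algebraMap ℚ_[p] ℂ_[p]).comp (algebraMap ℤ_[p] ℚ_[p])) (PowerSeries.coeff j L₁) *
            (ζ k - 1) ^ j -
          ((algebraMap ℚ_[p] ℂ_[p]).comp (algebraMap ℤ_[p] ℚ_[p])) (PowerSeries.coeff j L₂) *
            (ζ k - 1) ^ j := by
      funext j
      rw [hcoe, hDdef, map_sub, map_sub, sub_mul]
    rw [hfun]
    exact hsub
  -- the zeros `ζ_k - 1` are pairwise distinct (`orderOf (1 + z)` recovers the level)
  have hinjζ : Function.Injective fun k ↦ ζ k - 1 := by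
    intro a b hab
    have hζab : ζ a = ζ b := sub_left_injective hab
    have ho : p ^ lev a = p ^ lev b := by
      rw [(hζ a).eq_orderOf, (hζ b).eq_orderOf, hζab]
    exact hinj (Nat.pow_right_injective hp.two_le ho)
  exact hfin.not_infinite
    ((Set.infinite_range_of_injective hinjζ).mono (Set.range_subset_iff.mpr hmem))

/-- **Uniqueness of Pollack's `L_p^ε`**: two elements of `Λ` satisfying the parity-`ε` Mazur–Tate
congruences are equal (they agree at the infinitely many `ζ_n - 1`, `(-1)^n = ε`, of the open unit
disc, and a non-zero element of `Λ ⊗ ℚ_p` has finitely many zeros there). Consequently the named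
fact `thm41_signedCharIdeal_divisibility`, which quantifies over every such `L`, speaks about
Pollack's `L_p^ε(E, X)` itself. [cite: Pollack2003, Prop. 6.9 (proof) and §3] [cite: Kobayashi2003, Thm. 3.2 (p. 7)] -/
theorem IsSignedPAdicLFunction.unique {ε : ℤˣ} {L₁ L₂ : IwasawaAlgebra p}
    (h₁ : IsSignedPAdicLFunction f p ε L₁) (h₂ : IsSignedPAdicLFunction f p ε L₂) : L₁ = L₂ := by
  rcases Int.units_eq_one_or ε with rfl | rfl
  · refine h₁.eq_of_levels h₂ (fun k ↦ 2 * k + 2) (fun a b h ↦ by simpa using h) fun k ↦ ?_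
    rw [Int.negOnePow_eq_one_iff, Int.even_coe_nat]
    exact ⟨k + 1, by ring⟩
  · refine h₁.eq_of_levels h₂ (fun k ↦ 2 * k + 1) (fun a b h ↦ by simpa using h) fun k ↦ ?_
    rw [Int.negOnePow_eq_neg_one_iff, Int.odd_coe_nat]
    exact ⟨k, rfl⟩

/-- **Existence and uniqueness** (the tree's Pollack fact granted): for `p` odd, `f` the newform of
`E = W`, good reduction at `p` with `a_p = 0`, and either sign `ε`, there is EXACTLY ONE `L ∈ Λ` with
`IsSignedPAdicLFunction f p ε L` — Pollack's `L_p^ε(E, X)` in Kobayashi's labelling — and it is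
non-zero. [cite: Pollack2003, Thm. 5.6, Cor. 5.11 and Prop. 6.18] [cite: Kobayashi2003, Thm. 3.2 (p. 7)] -/
theorem existsUnique_isSignedPAdicLFunction [NeZero N] {W : WeierstrassCurve ℚ} [W.IsElliptic]
    [W.IsGloballyMinimal]
    (h : pollack_exists_plusMinusPAdicLFunction (W := W) (f := f) (p := p)) (hp : p ≠ 2)
    (hf : IsNewformOf W f) (hgood : W.HasGoodReductionAtPrime p) (hap : W.frobeniusTrace p = 0)
    (ε : ℤˣ) : (∃! L : IwasawaAlgebra p, IsSignedPAdicLFunction f p ε L) ∧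
      ∀ L : IwasawaAlgebra p, IsSignedPAdicLFunction f p ε L → L ≠ 0 := by
  obtain ⟨L₀, hL₀, hL⟩ := exists_isSignedPAdicLFunction h hp hf hgood hap ε
  refine ⟨⟨L₀, hL, fun L hL' ↦ hL'.unique hL⟩, fun L hL' h0 ↦ hL₀ ?_⟩
  rw [← h0]
  exact hL.unique hL'

end Literature.NumberTheory.EllipticCurves.Kobayashi2003

end
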